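import Mathlib.Tactic
import HarnessLib
import HarnessLib.Audit.Tags
import Summits.CriticalPhenomena.PercolationContinuityZ3.Theorems.PercNearOneGluingNoHeavyLowerTailSahiAntichainSplitEight
import Summits.CriticalPhenomena.PercolationContinuityZ3.Theorems.PercNearOneGluingNoHeavyLowerTailSahiAntichainDual

/-!
# Antichains, meets plus joins: the LINEAR form `f ≥ 2N` for `N ≥ 7` and the reduction of V5 to finitely many shape lemmas

Support file (seat `prim-masterthm-p1`, gen 37; `--supports stmt-CriticalPhenomena-4575`).  No `sorry`, standard axioms; two typed
statements (`def … : Prop`).  Memo `run/shared/lean/prim/prim-masterthm/FROM-prim-masterthm-p1-g37-LINEAR-REDUCTION.md`.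

SETTING (files `…SahiAntichainSplit*`): for a finite family `P` of finite sets, `meets P` / `joins P` are the pairwise meets / joins
of distinct members, `f P = #meets P + #joins P`; at a point `r`, `above P r` / `below P r` are the members containing / avoiding `r`
and `newLabels P r` the number of cross labels that are new, so that `f P = f (above) + f (below) + newLabels P r`
(`card_meets_add_card_joins_split`).  Conjecture **V5**: an antichain has `2 #P ≤ f P + 2`.  Kernel so far: V5 for `#P ≤ 8`
(`two_mul_card_le_of_card_le_eight`), the one- and two-member and (co)sunflower steps, the typed reductions `AntichainGoodPointOrRich`, (XY).

NEW HERE ([this work], gen 37): **the threshold reduction.**  The exhaustive data (all antichains of `2^6`; annealing on 7–10 points)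
say more than V5: the minimum of `f` over antichains with `N` members is `10, 10, 16, 20, 21, 21, 29, 33` for `N = 5, …, 12`, i.e.
**`f ≥ 2N` for every `N ≥ 7`** (the only families with `f ≤ 2N − 1` are those with `N ≤ 4` and the blow-ups of `C([4],2)`, `N = 6`).
Carrying the stronger statement `f ≥ 2N (N ≥ 7)` through the split induction makes the induction LOCAL again: at a split of a family with
`N ≥ 13` members one side has at least seven members, and
* if both sides have at least seven members, `f ≥ 2p + 2q + newLabels ≥ 2N` with no hypothesis on the point (bad points — the whole
  difficulty of the plain V5 induction, gens 35–36 — cost nothing);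
* if one side has at most six members, all that is needed is `2 p ≤ f (small side) + newLabels`, a statement about ONE small side of at
  most six members against an arbitrary other side (`AntichainSmallSide`, typed below): by the kernel's one- and two-member and (co)sunflower
  steps and `f(4) ≥ 7`, `f(5) ≥ 9`, `f(6) ≥ 10` it reduces to four finite shape lemmas (memo §2: a three-member side always creates a new
  label; `f(5) ≥ 10`; a four-member antichain with seven labels is a (co)sunflower; a six-member side with at most eleven labels is a
  `C([4],2)` blow-up and creates two — in data four — new labels), each verified exhaustively on `2^6` and by annealing on 7–9 points;
* the base range `7 ≤ N ≤ 12` (`AntichainMidRange`, typed below) is likewise a finite list of two-small-sides lemmas (memo §3).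
So **V5 follows from `AntichainMidRange ∧ AntichainSmallSide`** (`two_mul_card_le_of_linear`), and so does the sharper
`two_mul_card_le_linear : 7 ≤ #P → 2 #P ≤ f P`.  The dual small-side statement (small `below`) is derived here from the `above` version by
complement duality (`smallSide_below`).  EVIDENCE for the two typed statements: memo §1 (exhaustive `2^6`: 7 828 289 antichains; kit j288221).
HONEST FRAMING: `AntichainMidRange`, `AntichainSmallSide` and V5 remain OPEN; this file is the bookkeeping that turns V5 into a finite
list of shape lemmas. [this work]
-/

namespace Summit.CriticalPhenomena.PercolationContinuityZ3.Theorems.SahiColouredDaykin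

open Finset

variable {α : Type*} [DecidableEq α]

/-! ### 1. The two typed statements -/

/-- **MID RANGE (typed).**  Every antichain with `7 ≤ #P ≤ 12` members has `2 #P ≤ #meets P + #joins P`.  Exhaustive on `2^6`
(minima `16, 20, 21, 21, 29, 33` for `#P = 7, …, 12`) and under annealing on 7–10 points (same minima); reduces to finitely many
two-small-sides shape lemmas (memo §3).  [this work] [status: open] -/
@[conjecture] def AntichainMidRange (α : Type*) [DecidableEq α] : Prop :=
  ∀ P : Finset (Finset α), IsAntichain (· ⊆ ·) (P : Set (Finset α)) → 7 ≤ #P → #P ≤ 12 →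
    2 * #P ≤ #(meets P) + #(joins P)

/-- **SMALL SIDE (typed).**  At a point `r` of an antichain with at most six members above `r` and at least seven below,
`2 #(above) ≤ f (above) + newLabels P r`.  By the kernel steps this is automatic unless `above` is a non-(co)sunflower triple with five
labels (needs `newLabels ≥ 1`), a five-member family with nine labels (none exists: `f(5) ≥ 10`), or a six-member family with ten or
eleven labels (a `C([4],2)` blow-up; needs `newLabels ≥ 2`); exhaustive on `2^6`, annealing on 7–9 points (memo §2).  [this work] [status: open] -/
@[conjecture] def AntichainSmallSide (α : Type*) [DecidableEq α] : Prop :=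
  ∀ P : Finset (Finset α), IsAntichain (· ⊆ ·) (P : Set (Finset α)) → ∀ r : α,
    #(above P r) ≤ 6 → 7 ≤ #(below P r) →
      2 * #(above P r) ≤ #(meets (above P r)) + #(joins (above P r)) + newLabels P r

/-! ### 2. The dual small-side statement, by complementation -/

/-- **Small side below**, from `AntichainSmallSide` by complement duality (`…SahiAntichainDual`): at a point with at most six members
below and at least seven above, `2 #(below) ≤ f (below) + newLabels P r`. [this work] -/
theorem smallSide_below (h : AntichainSmallSide α) {P : Finset (Finset α)}
    (hanti : IsAntichain (· ⊆ ·) (P : Set (Finset α))) {r : α} (hB : #(below P r) ≤ 6) (hA : 7 ≤ #(above P r)) :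
    2 * #(below P r) ≤ #(meets (below P r)) + #(joins (below P r)) + newLabels P r := by
  set F := insert r (P.sup id) with hF
  have hP : ∀ a ∈ P, a ⊆ F := subset_insert_sup P r
  have hPB : ∀ a ∈ below P r, a ⊆ F := fun a ha => hP a (below_subset P r ha)
  have hr : r ∈ F := mem_insert_self _ _
  have h1 := h (P.image (F \ ·)) (isAntichain_image_compl hanti hP) r
    (by rw [card_above_image_compl hP hr]; exact hB) (by rw [card_below_image_compl hP hr]; exact hA)
  rw [newLabels_image_compl hP hr, above_image_compl (P := P) hr, card_image_compl hPB,
    card_meets_add_card_joins_image_compl hPB] at h1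
  exact h1

/-! ### 3. The linear form for `N ≥ 7`, and V5 -/

/-- **The linear form.**  Under `AntichainMidRange` and `AntichainSmallSide`, every antichain with at least seven members has
`2 #P ≤ #meets P + #joins P` — by strong induction on `#P`: the mid range is the base; for `#P ≥ 13` split at any effective point,
where a side with at least seven members is handled by the induction hypothesis and a side with at most six by the small-side statement,
and add up with the split identity. [this work] -/
theorem two_mul_card_le_linear (hM : AntichainMidRange α) (hS : AntichainSmallSide α) :
    ∀ P : Finset (Finset α), IsAntichain (· ⊆ ·) (P : Set (Finset α)) → 7 ≤ #P → 2 * #P ≤ #(meets P) + #(joins P) := by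
  suffices H : ∀ n, ∀ P : Finset (Finset α), #P = n → IsAntichain (· ⊆ ·) (P : Set (Finset α)) → 7 ≤ #P →
      2 * #P ≤ #(meets P) + #(joins P) from fun P hP h7 => H _ P rfl hP h7
  intro n
  induction n using Nat.strong_induction_on with
  | _ n ih =>
    intro P hPn hanti h7
    by_cases h12 : #P ≤ 12
    · exact hM P hanti h7 h12
    · obtain ⟨r, hr⟩ := effPoints_nonempty (by omega : 2 ≤ #P)
      obtain ⟨hA, hB⟩ := mem_effPoints_iff.1 hr
      have hcard := card_above_add_card_below P r
      have hApos : 0 < #(above P r) := card_pos.2 hA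
      have hBpos : 0 < #(below P r) := card_pos.2 hB
      have hsplit := card_meets_add_card_joins_split P r
      have hantiA := isAntichain_above hanti r
      have hantiB := isAntichain_below hanti r
      by_cases hA6 : #(above P r) ≤ 6
      · -- small side above, at least seven below
        have hB7 : 7 ≤ #(below P r) := by omega
        have h1 := hS P hanti r hA6 hB7
        have h2 := ih (#(below P r)) (by omega) (below P r) rfl hantiB hB7
        omega
      by_cases hB6 : #(below P r) ≤ 6
      · -- small side below, at least seven above
        have hA7 : 7 ≤ #(above P r) := by omega
        have h1 := smallSide_below hS hanti hB6 hA7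
        have h2 := ih (#(above P r)) (by omega) (above P r) rfl hantiA hA7
        omega
      · -- both sides have at least seven members: no hypothesis on the point is needed
        have h1 := ih (#(above P r)) (by omega) (above P r) rfl hantiA (by omega)
        have h2 := ih (#(below P r)) (by omega) (below P r) rfl hantiB (by omega)
        omega

/-- **V5 from the two finite statements**: under `AntichainMidRange` and `AntichainSmallSide` every antichain has
`2 #P ≤ #meets P + #joins P + 2` (for `#P ≤ 8` unconditionally by `two_mul_card_le_of_card_le_eight`, above that by the linear form). [this work] -/
theorem two_mul_card_le_of_linear (hM : AntichainMidRange α) (hS : AntichainSmallSide α) :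
    ∀ P : Finset (Finset α), IsAntichain (· ⊆ ·) (P : Set (Finset α)) → 2 * #P ≤ #(meets P) + #(joins P) + 2 := by
  intro P hanti
  by_cases h8 : #P ≤ 8
  · exact two_mul_card_le_of_card_le_eight P hanti h8
  · have := two_mul_card_le_linear hM hS P hanti (by omega)
    omega

/-- V1 from the two finite statements: `#P ≤ #meets P + 1` or `#P ≤ #joins P + 1` for every antichain. [this work] -/
theorem card_le_or_card_le_of_linear (hM : AntichainMidRange α) (hS : AntichainSmallSide α) (P : Finset (Finset α))
    (hanti : IsAntichain (· ⊆ ·) (P : Set (Finset α))) : #P ≤ #(meets P) + 1 ∨ #P ≤ #(joins P) + 1 :=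
  card_le_or_card_le_of_two_mul_card_le (two_mul_card_le_of_linear hM hS P hanti)

/-- The small-side statement is only ever needed in the weak form `2 p ≤ f (above) + newLabels`; in particular any lemma giving
`newLabels ≥ 2` at the point discharges it for that side, by V5 for at most eight members.  Recorded for the shape lemmas to come. [this work] -/
theorem smallSide_of_two_le_newLabels {P : Finset (Finset α)} (hanti : IsAntichain (· ⊆ ·) (P : Set (Finset α))) {r : α}
    (hA6 : #(above P r) ≤ 6) (hnew : 2 ≤ newLabels P r) :
    2 * #(above P r) ≤ #(meets (above P r)) + #(joins (above P r)) + newLabels P r := by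
  have := two_mul_card_le_of_card_le_eight (above P r) (isAntichain_above hanti r) (by omega)
  omega

end Summit.CriticalPhenomena.PercolationContinuityZ3.Theorems.SahiColouredDaykin
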